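import Mathlib.Algebra.BigOperators.Ring.Finset
import Mathlib.Algebra.BigOperators.Fin
import Mathlib.Data.Fin.Tuple.Basic
import Mathlib.Data.Real.Basic
import Mathlib.Algebra.Order.BigOperators.Ring.Finset
import Mathlib.Tactic.FieldSimp
import Mathlib.Tactic.Ring
import HarnessLib

/-!
# Weighted averages over `n`-tuples ([IUTchIV] Proposition 1.7) — STEP-0 calibration fragment,
# elementary-numerics genre (abc-iut cell)

Mochizuki, *Inter-universal Teichmüller theory IV: log-volume computations and set-theoretic
foundations*, Publ. RIMS **57** (2021) 627–723, §1, Proposition 1.7 "(Weighted Averages)" and its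
proof (PRIMS text p. 16–17). The statement is an elementary identity about finite weighted sums
(it is the bookkeeping behind the "packet-normalized log-volumes" of [IUTchIII] Prop. 3.9 (i), cf.
Remark 1.7.1) and involves nothing disputed; the bibliographic key of the series nevertheless carries
the D-0012 claim status, hence the tag form below [claim: Mochizuki2012, status: disputed].

**Statement.** Let `E` be a nonempty finite set, `n ≥ 1`, `λ_e > 0`, `β_e ∈ ℝ` for `e ∈ E`. For an
`n`-tuple `e = (e₁, …, eₙ) ∈ Eⁿ` put `β_e := Σⱼ β_{eⱼ}`, `λ_Πe := Πⱼ λ_{eⱼ}`; put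
`β_E := Σ_e β_e·λ_e`, `λ_E := Σ_e λ_e`, `β_avg := β_E/λ_E`. Then for every `i`,
`(Σ_{e∈Eⁿ} β_e·λ_Πe)/(Σ_{e∈Eⁿ} λ_Πe) = (Σ_{e∈Eⁿ} n·β_{eᵢ}·λ_Πe)/(Σ_{e∈Eⁿ} λ_Πe) = n·β_avg`.
We prove it exactly along the printed proof: `λ_Eⁿ = Σ λ_Πe`, `β_E·λ_E^{n-1} = Σ β_{eᵢ}·λ_Πe`,
then sum over `i`.
-/

namespace Literature.Algebra.PolynomialIdentities

open Finset

namespace WeightedAverage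

variable {E : Type*} [Fintype E]

/-- `β_e := Σⱼ β_{eⱼ}` for an `n`-tuple `e ∈ Eⁿ` ([IUTchIV] Prop. 1.7).
[claim: Mochizuki2012, status: disputed] -/
def tupleBeta (β : E → ℝ) {n : ℕ} (e : Fin n → E) : ℝ := ∑ j, β (e j)

/-- `λ_Πe := Πⱼ λ_{eⱼ}` for an `n`-tuple `e ∈ Eⁿ` ([IUTchIV] Prop. 1.7).
[claim: Mochizuki2012, status: disputed] -/
def tupleLam (lam : E → ℝ) {n : ℕ} (e : Fin n → E) : ℝ := ∏ j, lam (e j)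

/-- `β_E := Σ_e β_e · λ_e` ([IUTchIV] Prop. 1.7). [claim: Mochizuki2012, status: disputed] -/
def betaTotal (β lam : E → ℝ) : ℝ := ∑ e, β e * lam e

/-- `λ_E := Σ_e λ_e` ([IUTchIV] Prop. 1.7). [claim: Mochizuki2012, status: disputed] -/
def lamTotal (lam : E → ℝ) : ℝ := ∑ e, lam e

/-- `β_avg := β_E / λ_E` ([IUTchIV] Prop. 1.7). [claim: Mochizuki2012, status: disputed] -/
noncomputable def betaAvg (β lam : E → ℝ) : ℝ := betaTotal β lam / lamTotal lam

/-- First display of the proof of [IUTchIV] Prop. 1.7: `λ_Eⁿ = Σ_{e∈Eⁿ} λ_Πe`.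
[claim: Mochizuki2012, status: disputed] -/
theorem lamTotal_pow (lam : E → ℝ) (n : ℕ) :
    lamTotal lam ^ n = ∑ e : Fin n → E, tupleLam lam e :=
  Fintype.sum_pow lam n

/-- Second display of the proof of [IUTchIV] Prop. 1.7: `β_E · λ_E^{n-1} = Σ_{e∈Eⁿ} β_{eᵢ} · λ_Πe`
for every `i` (here `n = m + 1`). [claim: Mochizuki2012, status: disputed] -/
theorem betaTotal_mul_lamTotal_pow (β lam : E → ℝ) (m : ℕ) (i : Fin (m + 1)) :
    betaTotal β lam * lamTotal lam ^ m = ∑ e : Fin (m + 1) → E, β (e i) * tupleLam lam e := by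
  classical
  -- separate the `i`-th coordinate: `E^{m+1} ≃ E × E^m`
  rw [← Fintype.sum_equiv (Fin.insertNthEquiv (fun _ => E) i)
    (fun p : E × (Fin m → E) => β p.1 * (lam p.1 * ∏ j, lam (p.2 j)))
    (fun e : Fin (m + 1) → E => β (e i) * tupleLam lam e)]
  · rw [Fintype.sum_prod_type, betaTotal, lamTotal_pow, Finset.sum_mul]
    refine Finset.sum_congr rfl fun a _ => ?_
    rw [Finset.mul_sum]
    refine Finset.sum_congr rfl fun t _ => ?_
    unfold tupleLam
    ring
  · intro p
    simp only [tupleLam, Fin.insertNthEquiv_apply, Fin.insertNth_apply_same]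
    rw [Fin.prod_univ_succAbove _ i, Fin.insertNth_apply_same]
    simp only [Fin.insertNth_apply_succAbove]

/-- Third display of the proof of [IUTchIV] Prop. 1.7 (summing the second over `i`):
`n · β_E · λ_E^{n-1} = Σ_{e∈Eⁿ} β_e · λ_Πe`. [claim: Mochizuki2012, status: disputed] -/
theorem mul_betaTotal_mul_lamTotal_pow (β lam : E → ℝ) (m : ℕ) :
    (m + 1 : ℕ) * betaTotal β lam * lamTotal lam ^ m =
      ∑ e : Fin (m + 1) → E, tupleBeta β e * tupleLam lam e := by
  have h : ∀ i : Fin (m + 1), betaTotal β lam * lamTotal lam ^ m =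
      ∑ e : Fin (m + 1) → E, β (e i) * tupleLam lam e := betaTotal_mul_lamTotal_pow β lam m
  calc ((m + 1 : ℕ) : ℝ) * betaTotal β lam * lamTotal lam ^ m
      = ∑ _i : Fin (m + 1), betaTotal β lam * lamTotal lam ^ m := by
        rw [Finset.sum_const, Finset.card_univ, Fintype.card_fin, nsmul_eq_mul, mul_assoc]
    _ = ∑ i : Fin (m + 1), ∑ e : Fin (m + 1) → E, β (e i) * tupleLam lam e :=
        Finset.sum_congr rfl fun i _ => h i
    _ = ∑ e : Fin (m + 1) → E, ∑ i : Fin (m + 1), β (e i) * tupleLam lam e := Finset.sum_comm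
    _ = ∑ e : Fin (m + 1) → E, tupleBeta β e * tupleLam lam e :=
        Finset.sum_congr rfl fun e _ => by rw [tupleBeta, Finset.sum_mul]

/-- The denominator `Σ_{e∈Eⁿ} λ_Πe = λ_Eⁿ` is positive when `E ≠ ∅` and all `λ_e > 0`.
[claim: Mochizuki2012, status: disputed] -/
theorem lamTotal_pos [Nonempty E] {lam : E → ℝ} (hlam : ∀ e, 0 < lam e) : 0 < lamTotal lam :=
  Finset.sum_pos (fun e _ => hlam e) Finset.univ_nonempty

/-- **[IUTchIV] Proposition 1.7 (Weighted Averages).** For `E` nonempty finite, `n ≥ 1`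
(`n = m + 1`), `λ_e > 0`, `β_e ∈ ℝ` and any index `i`:
`(Σ_{e∈Eⁿ} β_e·λ_Πe)/(Σ λ_Πe) = n·β_avg` and `(Σ_{e∈Eⁿ} n·β_{eᵢ}·λ_Πe)/(Σ λ_Πe) = n·β_avg`.
[claim: Mochizuki2012, status: disputed] -/
theorem weightedAverage_eq [Nonempty E] (β lam : E → ℝ) (hlam : ∀ e, 0 < lam e) (m : ℕ)
    (i : Fin (m + 1)) :
    (∑ e : Fin (m + 1) → E, tupleBeta β e * tupleLam lam e) / (∑ e : Fin (m + 1) → E, tupleLam lam e)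
        = (m + 1 : ℕ) * betaAvg β lam ∧
      (∑ e : Fin (m + 1) → E, (m + 1 : ℕ) * β (e i) * tupleLam lam e) /
          (∑ e : Fin (m + 1) → E, tupleLam lam e) = (m + 1 : ℕ) * betaAvg β lam := by
  have hpos : 0 < lamTotal lam := lamTotal_pos hlam
  have hne : lamTotal lam ≠ 0 := hpos.ne'
  have hden : ∑ e : Fin (m + 1) → E, tupleLam lam e = lamTotal lam ^ m * lamTotal lam := by
    rw [← lamTotal_pow, pow_succ]
  constructor
  · rw [← mul_betaTotal_mul_lamTotal_pow, hden, betaAvg]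
    field_simp
  · have h2 : ∑ e : Fin (m + 1) → E, ((m + 1 : ℕ) : ℝ) * β (e i) * tupleLam lam e =
        (m + 1 : ℕ) * (betaTotal β lam * lamTotal lam ^ m) := by
      rw [betaTotal_mul_lamTotal_pow β lam m i, Finset.mul_sum]
      refine Finset.sum_congr rfl fun e _ => ?_
      ring
    rw [h2, hden, betaAvg]
    field_simp

end WeightedAverage

end Literature.Algebra.PolynomialIdentities
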